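import Literature.MathematicalPhysics.QuantumFieldTheory.BalabanImbrieJaffe1984to88.BIJ88Eq242HiggsCovarianceTorus
import Literature.MathematicalPhysics.QuantumFieldTheory.BalabanImbrieJaffe1984to88.BIJ88DeltaLoc234Torus
import Literature.MathematicalPhysics.QuantumFieldTheory.BalabanImbrieJaffe1984to88.BIJ88Locality246Lattice

/-!
# `BalabanImbrieJaffe1984to88.BIJ88DeltaLocULocalityTorus` — T. Bałaban, J. Imbrie, A. Jaffe, *Effective action and cluster properties of the
abelian Higgs model*, Commun. Math. Phys. **114** (1988) 257–315 [BalabanImbrieJaffe1988], §2 pp. 263–264 [PDF 7–8]: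
**THE `u`-LOCALITY OF THE CONCRETE TORUS OBJECTS, PROVED FROM THE DEFINITIONS** — p. 264 (line 2) *"Δ_{k,loc}(u; x₁, x₂) depends on u only in
an O(r(e_k))-neighborhood of x₁, x₂"*, p. 264 (2.43) *"The local part C^{(k)}_{Λ,loc}(u; x₁, x₂) depends only on u in an O(r(e_k)) neighborhood of
x₁, x₂"* and (2.46) *"The operator C^{(k)}_{Λ,X}(u) depends only on u in X"* — FOR GEN 15's `Δ_{k,loc}(u) = deltaLocT a c u k cube lam ζ″` (WITH
BODY: (2.27) `G_k(□_α,u) = gBox`, (2.28) `G_{k,loc}`, (2.34) on the torus `T^{(j)}`) AND FOR THE WALK OPERATORS OF GEN 23's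
`BIJ88Eq242HiggsCovarianceTorus` built on the charted realified `(Δ_{k,loc}(u) + κP(u_k))|_Λ`.  Locality is read IN THE BOND VARIABLES: two
backgrounds `u, u′` that agree on the bonds inside a site set `S` (`BondAgree S u u′`, both endpoints in `S` = r16's `starB S`) give equal objects.
The Neumann propagator `G_k(Ω,u)` sees only the bonds inside `Ω`; the averaging transporters `u(Γ^{(k)}_{yx})` only the bonds inside `B^k(y)`;
hence `Δ_{k,loc}(u; y₁, y₂)` only the bonds inside the `(k+1)`-blocks over `y₁, y₂` and inside the cubes `□_α` ACTIVE (`ζ″λ_α ≠ 0`) on the rows of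
`B^k(y₁)` — an `O(r(e_k))`-neighbourhood by (2.27)/(2.29) (`depSet_subset_near`); composed with p13's `BIJ88Locality246Lattice` (locality of the
walk terms IN THE OPERATOR, any `A, A′`) this gives the printed clauses of (2.43)/(2.46) for the model's `C^{(k)}_Λ(u)`.  Termwise statements: ANY
`a, c, κ`, cube family, weights `λ_α`, cut-off `ζ″`, cube size `M ≥ 1`, radius `ρ`; no smallness of `u`, no (5.6), no convergence.

statement-level skeleton of published theorems with citation tags; proofs where landed; nothing here is a claim about the Yang–Mills mass gap

CONTENTS.
* §1 **`BondAgree S u u′`** (`u = u′` on `starB S`): `mono`, `refl`, `symm`, `trans`, `apply`, `left`, `right`.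
* §2 one level ([I] (2.5), (2.10)): **`holC_congr`** (`u(Γ_{yx})` sees only `B(y)`: the legs stay in the block, r18's `blockOf_legSite`),
  **`lineU_congr`** (`u(Γ_{yy′})` sees only `B(y) ∪ B(y′)`: r18's `blockOf_runSite_lo`/`_L`).
* §3 iterates ([I] (5.1.2)–(5.1.3)): `fineOver k S = ⋃_{y∈S} B^k(y)`, **`lineIter_congr`** (`u^{(k)}` on the bonds inside `S` sees only the bonds
  inside `fineOver k S`; induction on `k`), **`holCK_congr`** (`u(Γ^{(k)}_{x_k x})` sees only `B^k(x_k)`).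
* §4 (2.27): `qMatK_congr`, `dN_congr`, `nOp_congr`, `nPad_congr`, **`gBox_congr`** (`G_k(Ω,u)` sees only the bonds inside `Ω` — as MATRICES).
* §5 (2.28)/(2.34): `qMatT_apply_congr`, `gLocT_apply_congr`, **`deltaLocT_apply_congr`** (p. 264 line 2 for the concrete `Δ_{k,loc}(u)`).
* §6 (4.10): `pOp_apply_congr`, `pOp_lineIter_apply_congr` (`P(u_k)(y₁,y₂)` sees only the `(k+1)`-blocks over `y₁, y₂`).
* §7 (2.40): **`depSet`** (the dependence set of a row: `B^{k+1}` over `y` ∪ the active cubes), `depSet_subset_near` (located: within the cube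
  diameter of `B^{k+1}`), **`op240_apply_congr`**, `realify_apply_congr`, `agreeOn_reOp`, **`uNbhd S`**, **`agreeOn_reOp_op240`** (p13's
  `AgreeOn S` for the charted realified `(Δ_{k,loc}(u) + κP(u_k))|_Λ` from `BondAgree (uNbhd S) u u′`).
* §8 THE PRINTED CLAUSES for the model's `C^{(k)}_Λ(u)`: **`cLoc_congr_bonds`** ((2.43): `C_{Λ,loc}(u; x₁, x₂) = C_{Λ,loc}(u′; x₁, x₂)` when
  `u = u′` on the bonds of `uNbhd` of the sites within `(ρ+1)M` of `x₁` and of `x₂`), **`cX_congr_bonds`** ((2.46): `C_{Λ,X}(u) = C_{Λ,X}(u′)` when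
  `u = u′` on the bonds of `uNbhd (sitesOf X)`) — p13's `cLoc_congr_local` / `cX_congr_local` BY NAME (their §5 `hloc` hypothesis DISCHARGED);
  `cLoc_reOp_eq_zero_of_far` ((2.43) *"it vanishes for |x₁ − x₂| > ½r(e_k)"* for any charted torus operator, p13's `cLoc_eq_zero_of_far`).

HONEST SCOPE / DIVERGENCE.  (i) "in X" / "in an O(r(e_k))-neighborhood" are made EXPLICIT finite bond sets (`starB` of `uNbhd …`): the
`(k+1)`-blocks over the rows plus the cubes active on them; that this is an `O(r(e_k))`-neighbourhood is the located `depSet_subset_near` under the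
(2.27) row hypothesis (ii) and a cube-diameter bound (both hold for the printed torus data of p29/gen 22, not re-instantiated here), and p13's
`sitesOf X` exceeds the union of the `r(e_k)`-cubes of `X` by less than one `M`-layer (their scope note).  (ii) Statements for the charted realified
operator of gen 23 (`reOp`) and p13's walk terms `latticeCw` on the charted `Λ′ ⊂ ℤ^d`; any `κ` (print `aL^{−2}`), any level `j` with `j + k + 1 ≤
m + K`.  (iii) The `u`-locality of the RESUMMED objects needs no convergence: the clauses are identities of the formal walk sums (`tsum`s agree
termwise), exactly as in p13's file.
Imports: gen 23 `BIJ88Eq242HiggsCovarianceTorus`, gen 15 `BIJ88DeltaLoc234Torus`, p13 `BIJ88Locality246Lattice`.  Literature + Mathlib only.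
Unit `lit-balaban-p31` (literature-prover-lit-balaban-p31-g23-0), 2026-08-23.  NOT summit progress.
-/

open scoped BigOperators Matrix ComplexConjugate
open Finset Matrix

namespace Literature.MathematicalPhysics.QuantumFieldTheory.BalabanImbrieJaffe1984to88.BIJ88DeltaLocULocalityTorus

open Literature.MathematicalPhysics.QuantumFieldTheory.Balaban1983to89
open BIJ88Sect3Statements (U1 toC cfg starB mem_starB)
open BIJ85BlockAveragesTorus BIJ85BlockAveragesTorusK
open BIJ88RenormTransf311 (inBlock)
open BIJ88Vj5610Operator (dMat chiN)
open BIJ88NeumannPropagator227Torus (gBox nOp nPad dN qMatK qMatK_apply nOp_eq)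
open BIJ88DeltaLoc234Torus (qMatT deltaLocT gLocT gTilde gLocT_apply gTilde_apply qMatT_apply)
open BIJ88Eq240FlatTorus (realify compress op240 pOp)
open BIJ88RandomWalk242 BIJ88Eq242Lattice BIJ88Ineq246Lattice B4Sect5CubeBounds
open BIJ88Locality246Lattice (AgreeOn nbhd sitesOf cLoc_congr_local cX_congr_local)
open BIJ88Eq242HiggsCovarianceTorus (chart chartSet idxEquiv reOp reOp_apply coe_idxEquiv_fst cdist dist_idxEquiv)

noncomputable section

variable {P : Params} {j : ℕ}

/-! ## §1 Agreement of two bond fields on the bonds inside a site set -/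

section Agree

/-- **`u = u′` on the bonds inside `S`** (both endpoints in `S`: r16's `starB S`) — the print's *"depends on u only in S"* is
*"`BondAgree S u u′ ⇒` equal values"*. [cite: BalabanImbrieJaffe1988, (2.46) p.264] -/
def BondAgree (S : Finset (Balaban1983to89.Site P j)) (U U' : GaugeField P j U1) : Prop := ∀ b ∈ starB S, U b = U' b

namespace BondAgree

variable {S T : Finset (Balaban1983to89.Site P j)} {U U' U'' : GaugeField P j U1}

/-- agreement on a smaller set. [cite: BalabanImbrieJaffe1988, (2.46) p.264] -/
theorem mono (hST : S ⊆ T) (h : BondAgree T U U') : BondAgree S U U' := fun b hb => by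
  rw [mem_starB] at hb
  exact h b ((mem_starB T b).2 ⟨hST hb.1, hST hb.2⟩)

/-- reflexivity. [cite: BalabanImbrieJaffe1988, (2.46) p.264] -/
theorem refl (S : Finset (Balaban1983to89.Site P j)) (U : GaugeField P j U1) : BondAgree S U U := fun _ _ => rfl

/-- symmetry. [cite: BalabanImbrieJaffe1988, (2.46) p.264] -/
theorem symm (h : BondAgree S U U') : BondAgree S U' U := fun b hb => (h b hb).symm

/-- transitivity. [cite: BalabanImbrieJaffe1988, (2.46) p.264] -/
theorem trans (h : BondAgree S U U') (h' : BondAgree S U' U'') : BondAgree S U U'' := fun b hb => (h b hb).trans (h' b hb)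

/-- the value form: a bond with both endpoints in `S` carries equal variables. [cite: BalabanImbrieJaffe1988, (2.46) p.264] -/
theorem apply (h : BondAgree S U U') {b : PBond P j} (hs : b.src ∈ S) (ht : b.tgt ∈ S) : U b = U' b := h b ((mem_starB S b).2 ⟨hs, ht⟩)

/-- agreement on a union restricts to each part. [cite: BalabanImbrieJaffe1988, (2.46) p.264] -/
theorem left (h : BondAgree (S ∪ T) U U') : BondAgree S U U' := h.mono subset_union_left

/-- agreement on a union restricts to each part. [cite: BalabanImbrieJaffe1988, (2.46) p.264] -/
theorem right (h : BondAgree (S ∪ T) U U') : BondAgree T U U' := h.mono subset_union_right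

end BondAgree

end Agree

/-! ## §2 One averaging level: the contour transports `u(Γ_{yx})` and the runs `u(Γ_{yy′})` see only the bonds of their blocks -/

section OneLevel

variable {U U' : GaugeField P j U1}

/-- the transport along one leg of `Γ_{yx}` sees only the bonds inside `B(y)`, `y = blockOf x`. [cite: BalabanImbrieJaffe1985, (2.5) p.302] -/
theorem legProd_congr (hj : j + 1 ≤ P.m + P.K) {x : Balaban1983to89.Site P j} (μ : Fin P.d) (h : BondAgree (block (blockOf x)) U U') :
    legProd U x μ = legProd U' x μ := by
  unfold legProd
  refine Finset.prod_congr rfl fun t ht => ?_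
  rw [Finset.mem_range] at ht
  have hL : inBlock x μ < P.L := Nat.mod_lt _ P.L_pos
  have h1 : blockOf (legSite x μ t) = blockOf x := blockOf_legSite hj x μ ⟨t, by omega⟩
  have h2 : blockOf (legSite x μ (t + 1)) = blockOf x := blockOf_legSite hj x μ ⟨t + 1, by omega⟩
  rw [h.apply (b := legBond x μ t) (mem_block_iff.2 h1) (by rw [legBond_tgt]; exact mem_block_iff.2 h2)]

/-- **`u(Γ_{yx})` depends on `u` only inside `B(y)`.** [cite: BalabanImbrieJaffe1985, (2.5) p.302] -/
theorem holC_congr (hj : j + 1 ≤ P.m + P.K) {x : Balaban1983to89.Site P j} (h : BondAgree (block (blockOf x)) U U') : holC U x = holC U' x :=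
  Finset.prod_congr rfl fun μ _ => legProd_congr hj μ h

/-- a run product sees only its bonds. [cite: BalabanImbrieJaffe1985, (2.10) p.303] -/
theorem runProd_congr {x : Balaban1983to89.Site P j} {μ : Fin P.d} :
    ∀ {n : ℕ}, (∀ t < n, U (runBond x μ t) = U' (runBond x μ t)) → runProd U x μ n = runProd U' x μ n
  | 0, _ => rfl
  | n + 1, h => by rw [runProd, runProd, runProd_congr (fun t ht => h t (by omega)), h n (by omega)]

/-- **`u(Γ_{yy′})` (the `L`-lattice bond variable `lineU u ⟨y, y′⟩`) depends on `u` only inside `B(y) ∪ B(y′)`** — the run from the corner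
of `y` to the corner of `y′` stays in `B(y)` except for its endpoint. [cite: BalabanImbrieJaffe1985, (2.10) p.303] -/
theorem lineU_congr (hj : j + 1 ≤ P.m + P.K) (c : PBond P (j+1)) (h : BondAgree (block c.src ∪ block c.tgt) U U') : lineU U c = lineU U' c := by
  unfold lineU
  refine runProd_congr fun t ht => h.apply ?_ ?_
  · have hb : blockOf (runSite (corner c.src) c.dir t) = c.src := by
      rw [blockOf_runSite_lo hj _ _ (by rw [inBlock_corner hj]; omega), blockOf_corner hj]
    exact Finset.mem_union_left _ (mem_block_iff.2 hb)
  · rw [runBond_tgt]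
    by_cases hL : t + 1 < P.L
    · have hb : blockOf (runSite (corner c.src) c.dir (t + 1)) = c.src := by
        rw [blockOf_runSite_lo hj _ _ (by rw [inBlock_corner hj]; omega), blockOf_corner hj]
      exact Finset.mem_union_left _ (mem_block_iff.2 hb)
    · have ht1 : t + 1 = P.L := by omega
      rw [ht1]
      have hb : blockOf (runSite (corner c.src) c.dir P.L) = c.tgt := by
        rw [blockOf_runSite_L hj, blockOf_corner hj]; rfl
      exact Finset.mem_union_right _ (mem_block_iff.2 hb)

end OneLevel

/-! ## §3 The iterates: `u^{(k)} = lineIter u k` and `u(Γ^{(k)}_{yx}) = holCK u k x` see only the bonds of the `k`-blocks -/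

section Iter

variable {U U' : GaugeField P j U1}

/-- the fine sites lying over a set `S` of `k`-sites: `⋃_{y ∈ S} B^k(y)`. [cite: BalabanImbrieJaffe1985, (5.1.2)–(5.1.3) p.313] -/
def fineOver (k : ℕ) (S : Finset (Balaban1983to89.Site P (j+k))) : Finset (Balaban1983to89.Site P j) := univ.filter fun x => blkIter k x ∈ S

/-- membership. [cite: BalabanImbrieJaffe1985, (5.1.2)–(5.1.3) p.313] -/
theorem mem_fineOver {k : ℕ} {S : Finset (Balaban1983to89.Site P (j+k))} {x : Balaban1983to89.Site P j} :
    x ∈ fineOver k S ↔ blkIter k x ∈ S := by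
  simp [fineOver]

/-- the fine sites over the block of `w` are `B^{k+1}(w)`. [cite: BalabanImbrieJaffe1985, (5.1.2)–(5.1.3) p.313] -/
theorem fineOver_block (k : ℕ) (w : Balaban1983to89.Site P (j+k+1)) : fineOver k (block w) = blockK (k+1) w := by
  ext x
  rw [mem_fineOver, mem_block_iff, mem_blockK, blkIter_succ]

/-- `B^k(x_k) ⊆ B^{k+1}(x_{k+1})`. [cite: BalabanImbrieJaffe1985, (5.1.2)–(5.1.3) p.313] -/
theorem blockK_subset_blockK_succ (k : ℕ) (y : Balaban1983to89.Site P (j+k)) : blockK k y ⊆ blockK (k+1) (blockOf y) := by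
  intro z hz
  rw [mem_blockK] at hz ⊢
  rw [blkIter_succ, hz]

/-- **`u^{(k)}` on the `L^k`-lattice bonds inside `S` depends on `u` only on the bonds inside `⋃_{y∈S} B^k(y)`.**
[cite: BalabanImbrieJaffe1985, (5.1.2)–(5.1.3) p.313] -/
theorem lineIter_congr : ∀ (k : ℕ), j + k ≤ P.m + P.K → ∀ (S : Finset (Balaban1983to89.Site P (j+k))),
    BondAgree (fineOver k S) U U' → BondAgree S (lineIter U k) (lineIter U' k)
  | 0, _, S, h => by
    intro b hb
    refine h b ?_
    rw [mem_starB] at hb ⊢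
    exact ⟨mem_fineOver.2 hb.1, mem_fineOver.2 hb.2⟩
  | k + 1, hk, S, h => by
    intro c hc
    rw [mem_starB] at hc
    rw [lineIter_succ, lineIter_succ]
    have hk0 : j + k ≤ P.m + P.K := by omega
    have hk1 : j + k + 1 ≤ P.m + P.K := by omega
    have hS' : BondAgree (univ.filter fun y : Balaban1983to89.Site P (j+k) => blockOf y ∈ S) (lineIter U k) (lineIter U' k) := by
      refine lineIter_congr k hk0 _ (h.mono fun x hx => ?_)
      rw [mem_fineOver, Finset.mem_filter] at hx
      exact mem_fineOver.2 hx.2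
    refine lineU_congr hk1 c (hS'.mono fun y hy => ?_)
    rw [Finset.mem_union, mem_block_iff, mem_block_iff] at hy
    rw [Finset.mem_filter]
    refine ⟨mem_univ _, ?_⟩
    rcases hy with h1 | h1
    · rw [h1]; exact hc.1
    · rw [h1]; exact hc.2

/-- **`u(Γ^{(k)}_{x_k,x})` depends on `u` only on the bonds inside `B^k(x_k)`** (the composite contour (5.1.3) stays in the `k`-block).
[cite: BalabanImbrieJaffe1985, (5.1.2)–(5.1.3) p.313] -/
theorem holCK_congr : ∀ (k : ℕ), j + k ≤ P.m + P.K → ∀ (x : Balaban1983to89.Site P j),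
    BondAgree (blockK k (blkIter k x)) U U' → holCK U k x = holCK U' k x
  | 0, _, _, _ => rfl
  | k + 1, hk, x, h => by
    rw [holCK_succ, holCK_succ]
    have hk0 : j + k ≤ P.m + P.K := by omega
    have hk1 : j + k + 1 ≤ P.m + P.K := by omega
    have hsub : blockK k (blkIter k x) ⊆ blockK (k+1) (blkIter (k+1) x) := by
      rw [blkIter_succ]; exact blockK_subset_blockK_succ k _
    rw [holCK_congr k hk0 x (h.mono hsub)]
    congr 1
    refine holC_congr hk1 (lineIter_congr k hk0 _ (h.mono fun z hz => ?_))
    rw [fineOver_block] at hz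
    rwa [blkIter_succ]

end Iter

/-! ## §4 The Neumann propagator `G_k(Ω,u)` of (2.27) sees only the bonds inside `Ω` -/

section Neumann

variable {U U' : GaugeField P j U1} {Ω : Finset (Balaban1983to89.Site P j)} {k : ℕ}

/-- `Q_k(u)|_Ω` sees only the bonds inside `Ω`. [cite: BalabanImbrieJaffe1988, (2.27) p.263] -/
theorem qMatK_congr (hk : j + k ≤ P.m + P.K) (h : BondAgree Ω U U') : qMatK U k Ω = qMatK U' k Ω := by
  ext y x
  rw [qMatK_apply, qMatK_apply]
  split_ifs with hx
  · have hy : blkIter k x = y := mem_blockK.1 hx.2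
    rw [holCK_congr k hk x (h.mono (by rw [hy]; exact hx.1))]
  · rfl

/-- the Neumann-cut covariant derivative `χ_ΩD_u` sees only the bonds inside `Ω`. [cite: BalabanImbrieJaffe1988, (2.27) p.263] -/
theorem dN_congr (c : ℝ) (h : BondAgree Ω U U') : dN c U Ω = dN c U' Ω := by
  ext b x
  unfold dN chiN
  rw [Matrix.diagonal_mul, Matrix.diagonal_mul]
  by_cases hb : b ∈ starB Ω
  · simp only [dMat, Matrix.of_apply, cfg, h b hb]
  · rw [if_neg hb, zero_mul, zero_mul]

/-- `−Δ^N_{u,Ω} + a_kQ_k^*Q_k` sees only the bonds inside `Ω`. [cite: BalabanImbrieJaffe1988, (2.27) p.263] -/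
theorem nOp_congr {a c : ℝ} (hk : j + k ≤ P.m + P.K) (h : BondAgree Ω U U') : nOp a c U k Ω = nOp a c U' k Ω := by
  rw [nOp_eq, nOp_eq, dN_congr c h, qMatK_congr hk h]

/-- the padded operator sees only the bonds inside `Ω`. [cite: BalabanImbrieJaffe1988, (2.27) p.263] -/
theorem nPad_congr {a c : ℝ} (hk : j + k ≤ P.m + P.K) (h : BondAgree Ω U U') : nPad a c U k Ω = nPad a c U' k Ω := by
  unfold nPad
  rw [nOp_congr hk h]

/-- **`G_k(Ω,u)` DEPENDS ON `u` ONLY ON THE BONDS INSIDE `Ω`** (in particular *"C^{(k)}_{Λ,X}(u) depends only on u in X"* begins here: the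
cube propagators `G_k(□_α,u)` of (2.27) see only `u|_{□_α}`). [cite: BalabanImbrieJaffe1988, (2.27) p.263] -/
theorem gBox_congr {a c : ℝ} (hk : j + k ≤ P.m + P.K) (h : BondAgree Ω U U') : gBox a c U k Ω = gBox a c U' k Ω := by
  unfold gBox
  rw [nPad_congr hk h]

end Neumann

/-! ## §5 `Δ_{k,loc}(u; y₁, y₂)` *"depends on u only in an O(r(e_k))-neighborhood of x₁, x₂"* (p. 264) -/

section DeltaLoc

variable {U U' : GaugeField P j U1} {k : ℕ} {ι : Type*} [Fintype ι]

/-- the entries of `Q_k(u)` in row `y` see only the bonds inside `B^k(y)`. [cite: BalabanImbrieJaffe1985, (4.6.1) p.313] -/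
theorem qMatT_apply_congr (hk : j + k ≤ P.m + P.K) {y : Balaban1983to89.Site P (j+k)} (h : BondAgree (blockK k y) U U')
    (x : Balaban1983to89.Site P j) : qMatT U k y x = qMatT U' k y x := by
  rw [qMatT_apply, qMatT_apply]
  split_ifs with hx
  · rw [holCK_congr k hk x (by rwa [mem_blockK.1 hx])]
  · rfl

/-- the entry `G_{k,loc}(u; x₁, x₂)` of (2.28) sees only the bonds inside the cubes `□_α` active at `(x₁, x₂)` (`ζ″(x₁,x₂)λ_α(x₁,x₂) ≠ 0`).
[cite: BalabanImbrieJaffe1988, (2.28) p.263] -/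
theorem gLocT_apply_congr (hk : j + k ≤ P.m + P.K) {a c : ℝ} {cube : ι → Finset (Balaban1983to89.Site P j)}
    {lam : ι → Balaban1983to89.Site P j → Balaban1983to89.Site P j → ℝ} {ζ'' : Balaban1983to89.Site P j → Balaban1983to89.Site P j → ℝ}
    {x₁ x₂ : Balaban1983to89.Site P j} (h : ∀ α, ζ'' x₁ x₂ * lam α x₁ x₂ ≠ 0 → BondAgree (cube α) U U') :
    gLocT a c U k cube lam ζ'' x₁ x₂ = gLocT a c U' k cube lam ζ'' x₁ x₂ := by
  rw [gLocT_apply, gLocT_apply, gTilde_apply, gTilde_apply]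
  by_cases hζ : ζ'' x₁ x₂ = 0
  · rw [hζ, Complex.ofReal_zero, zero_mul, zero_mul]
  · refine congrArg (fun t : ℂ => (ζ'' x₁ x₂ : ℂ) * t) (Finset.sum_congr rfl fun α _ => ?_)
    by_cases hl : lam α x₁ x₂ = 0
    · rw [hl, Complex.ofReal_zero, zero_mul, zero_mul]
    · rw [gBox_congr hk (h α (mul_ne_zero hζ hl))]

/-- **p. 264: *"Δ_{k,loc}(u; x₁, x₂) depends on u only in an O(r(e_k))-neighborhood of x₁, x₂"* FOR GEN 15's CONCRETE `Δ_{k,loc}(u)`** —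
the entry `Δ_{k,loc}(u; y₁, y₂) = aδ − a²Σ_{x₁∈B^k(y₁), x₂∈B^k(y₂)} Q_k(u)(y₁,x₁)G_{k,loc}(u; x₁,x₂)Q_k(u)(y₂,x₂)^*` sees only the bonds inside
`B^k(y₁)`, `B^k(y₂)` and the cubes `□_α` active at the pairs `(x₁, x₂) ∈ B^k(y₁) × B^k(y₂)` (by (2.29) those pairs have `|x₁ − x₂| < R₀` and by
(2.27) the active cubes contain them: an `O(r(e_k))`-neighbourhood).  ANY `a, c`, cube family, weights, cut-off; no smallness.
[cite: BalabanImbrieJaffe1988, (2.34) p.263, p.264 (line 2)] -/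
theorem deltaLocT_apply_congr (hk : j + k ≤ P.m + P.K) {a c : ℝ} {cube : ι → Finset (Balaban1983to89.Site P j)}
    {lam : ι → Balaban1983to89.Site P j → Balaban1983to89.Site P j → ℝ} {ζ'' : Balaban1983to89.Site P j → Balaban1983to89.Site P j → ℝ}
    {y₁ y₂ : Balaban1983to89.Site P (j+k)} (h₁ : BondAgree (blockK k y₁) U U') (h₂ : BondAgree (blockK k y₂) U U')
    (hG : ∀ x₁ ∈ blockK k y₁, ∀ x₂ ∈ blockK k y₂, ∀ α, ζ'' x₁ x₂ * lam α x₁ x₂ ≠ 0 → BondAgree (cube α) U U') :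
    deltaLocT a c U k cube lam ζ'' y₁ y₂ = deltaLocT a c U' k cube lam ζ'' y₁ y₂ := by
  have key : (qMatT U k * gLocT a c U k cube lam ζ'' * (qMatT U k)ᴴ) y₁ y₂ =
      (qMatT U' k * gLocT a c U' k cube lam ζ'' * (qMatT U' k)ᴴ) y₁ y₂ := by
    rw [Matrix.mul_apply, Matrix.mul_apply]
    refine Finset.sum_congr rfl fun x₂ _ => ?_
    rw [Matrix.conjTranspose_apply, Matrix.conjTranspose_apply]
    by_cases hx₂ : x₂ ∈ blockK k y₂
    · rw [qMatT_apply_congr hk h₂ x₂]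
      refine congrArg (fun t : ℂ => t * star (qMatT U' k y₂ x₂)) ?_
      rw [Matrix.mul_apply, Matrix.mul_apply]
      refine Finset.sum_congr rfl fun x₁ _ => ?_
      by_cases hx₁ : x₁ ∈ blockK k y₁
      · rw [qMatT_apply_congr hk h₁ x₁, gLocT_apply_congr hk (hG x₁ hx₁ x₂ hx₂)]
      · rw [qMatT_apply U k y₁ x₁, qMatT_apply U' k y₁ x₁, if_neg hx₁, if_neg hx₁, zero_mul, zero_mul]
    · rw [qMatT_apply U k y₂ x₂, qMatT_apply U' k y₂ x₂, if_neg hx₂, if_neg hx₂, star_zero, mul_zero, mul_zero]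
  have e1 : deltaLocT a c U k cube lam ζ'' y₁ y₂ =
      (a : ℂ) • (1 : Matrix _ _ ℂ) y₁ y₂ - ((a : ℂ) ^ 2) • (qMatT U k * gLocT a c U k cube lam ζ'' * (qMatT U k)ᴴ) y₁ y₂ := rfl
  have e2 : deltaLocT a c U' k cube lam ζ'' y₁ y₂ =
      (a : ℂ) • (1 : Matrix _ _ ℂ) y₁ y₂ - ((a : ℂ) ^ 2) • (qMatT U' k * gLocT a c U' k cube lam ζ'' * (qMatT U' k)ᴴ) y₁ y₂ := rfl
  rw [e1, e2, key]

end DeltaLoc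

/-! ## §6 `P(u_k)(y₁, y₂)` sees only the bonds inside the `(k+1)`-blocks of `y₁, y₂` -/

section Pop

variable {k : ℕ}

/-- the entries of `P(v) = Q(v)^*Q(v)` at a level-`(j+k)` field `v` see only the `v`-bonds inside the `L`-blocks of the two sites.
[cite: BalabanImbrieJaffe1988, (4.10) p.275] -/
theorem pOp_apply_congr (hk1 : j + k + 1 ≤ P.m + P.K) {V V' : GaugeField P (j+k) U1} {y₁ y₂ : Balaban1983to89.Site P (j+k)}
    (h₁ : BondAgree (block (blockOf y₁)) V V') (h₂ : BondAgree (block (blockOf y₂)) V V') : pOp V y₁ y₂ = pOp V' y₁ y₂ := by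
  unfold pOp
  rw [Matrix.mul_apply, Matrix.mul_apply]
  refine Finset.sum_congr rfl fun z _ => ?_
  rw [Matrix.conjTranspose_apply, Matrix.conjTranspose_apply, qMatT_apply, qMatT_apply, qMatT_apply, qMatT_apply]
  by_cases hy₁ : y₁ ∈ blockK 1 z
  · by_cases hy₂ : y₂ ∈ blockK 1 z
    · rw [if_pos hy₁, if_pos hy₁, if_pos hy₂, if_pos hy₂, holCK_one, holCK_one, holCK_one, holCK_one, holC_congr hk1 h₁, holC_congr hk1 h₂]
    · rw [if_neg hy₂, if_neg hy₂, mul_zero, mul_zero]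
  · rw [if_neg hy₁, if_neg hy₁, star_zero, zero_mul, zero_mul]

/-- **`P(u_k)(y₁, y₂)`, `u_k = lineIter u k`, depends on `u` only on the bonds inside `B^{k+1}` of the `L`-blocks of `y₁` and `y₂`.**
[cite: BalabanImbrieJaffe1988, (4.10) p.275] -/
theorem pOp_lineIter_apply_congr (hk1 : j + k + 1 ≤ P.m + P.K) {U U' : GaugeField P j U1} {y₁ y₂ : Balaban1983to89.Site P (j+k)}
    (h₁ : BondAgree (blockK (k+1) (blockOf y₁)) U U') (h₂ : BondAgree (blockK (k+1) (blockOf y₂)) U U') :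
    pOp (lineIter U k) y₁ y₂ = pOp (lineIter U' k) y₁ y₂ := by
  have hk : j + k ≤ P.m + P.K := by omega
  refine pOp_apply_congr hk1 (lineIter_congr k hk _ ?_) (lineIter_congr k hk _ ?_)
  · rwa [fineOver_block]
  · rwa [fineOver_block]

end Pop

/-! ## §7 The operator `Δ_{k,loc}(u) + κP(u_k)` of (2.40): its entries and its charted realification -/

section Op240

variable {k : ℕ} {ι : Type*} [Fintype ι] {U U' : GaugeField P j U1}

open Classical in
/-- **the `u`-dependence set of the row `y`** of `Δ_{k,loc}(u) + κP(u_k)`: the `(k+1)`-block over the `L`-block of `y` together with the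
cubes `□_α` active (`ζ″λ_α ≠ 0`) on some row `x₁ ∈ B^k(y)` — under (2.27)/(2.29) an `O(r(e_k))`-neighbourhood of `B^k(y)`.
[cite: BalabanImbrieJaffe1988, p.264 ("O(r(e_k))-neighborhood of x₁, x₂")] -/
def depSet (k : ℕ) (cube : ι → Finset (Balaban1983to89.Site P j)) (lam : ι → Balaban1983to89.Site P j → Balaban1983to89.Site P j → ℝ)
    (ζ'' : Balaban1983to89.Site P j → Balaban1983to89.Site P j → ℝ) (y : Balaban1983to89.Site P (j+k)) : Finset (Balaban1983to89.Site P j) :=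
  blockK (k+1) (blockOf y) ∪ (univ.filter fun α => ∃ x₁ ∈ blockK k y, ∃ x₂, ζ'' x₁ x₂ * lam α x₁ x₂ ≠ 0).biUnion cube

variable {cube : ι → Finset (Balaban1983to89.Site P j)} {lam : ι → Balaban1983to89.Site P j → Balaban1983to89.Site P j → ℝ}
  {ζ'' : Balaban1983to89.Site P j → Balaban1983to89.Site P j → ℝ}

/-- the `(k+1)`-block part. [cite: BalabanImbrieJaffe1988, p.264 ("O(r(e_k))-neighborhood of x₁, x₂")] -/
theorem blockK_succ_subset_depSet (y : Balaban1983to89.Site P (j+k)) : blockK (k+1) (blockOf y) ⊆ depSet k cube lam ζ'' y :=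
  subset_union_left

/-- the `k`-block part. [cite: BalabanImbrieJaffe1988, p.264 ("O(r(e_k))-neighborhood of x₁, x₂")] -/
theorem blockK_subset_depSet (y : Balaban1983to89.Site P (j+k)) : blockK k y ⊆ depSet k cube lam ζ'' y :=
  (blockK_subset_blockK_succ k y).trans (blockK_succ_subset_depSet y)

/-- the active cubes. [cite: BalabanImbrieJaffe1988, p.264 ("O(r(e_k))-neighborhood of x₁, x₂")] -/
theorem cube_subset_depSet {y : Balaban1983to89.Site P (j+k)} {x₁ : Balaban1983to89.Site P j} (hx₁ : x₁ ∈ blockK k y)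
    {x₂ : Balaban1983to89.Site P j} {α : ι} (hα : ζ'' x₁ x₂ * lam α x₁ x₂ ≠ 0) : cube α ⊆ depSet k cube lam ζ'' y := by
  classical
  intro z hz
  refine Finset.mem_union_right _ (Finset.mem_biUnion.2 ⟨α, ?_, hz⟩)
  exact Finset.mem_filter.2 ⟨mem_univ _, x₁, hx₁, x₂, hα⟩

/-- **the dependence set is an `O(r(e_k))`-neighbourhood** (located): if every active pair `(x₁, x₂)`, `ζ″(x₁,x₂)λ_α(x₁,x₂) ≠ 0`, has
`x₁ ∈ □_α` (row hypothesis (ii) of (2.27): p29's `rowHyp_ii_torus` / gen 22's `rows_of_deep`) and the cubes have torus diameter `≤ D_c`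
(`D_c = O(r(e_k))`), then every site of `depSet y` lies within torus distance `D_c` of the `(k+1)`-block over `y`.
[cite: BalabanImbrieJaffe1988, (2.27) p.263, p.264 ("O(r(e_k))-neighborhood of x₁, x₂")] -/
theorem depSet_subset_near {y : Balaban1983to89.Site P (j+k)} {Dc : ℝ} (hDc : 0 ≤ Dc)
    (hrow : ∀ x₁ ∈ blockK k y, ∀ (α : ι) (x₂ : Balaban1983to89.Site P j), ζ'' x₁ x₂ * lam α x₁ x₂ ≠ 0 → x₁ ∈ cube α)
    (hdiam : ∀ α, ∀ z ∈ cube α, ∀ z' ∈ cube α, B5Ineq137Torus.T P j z z' ≤ Dc) :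
    ∀ z ∈ depSet k cube lam ζ'' y, ∃ x ∈ blockK (k+1) (blockOf y), B5Ineq137Torus.T P j x z ≤ Dc := by
  classical
  intro z hz
  rcases Finset.mem_union.1 hz with hz | hz
  · exact ⟨z, hz, by rw [B5Ineq137Torus.T_self]; exact hDc⟩
  · obtain ⟨α, hα, hzα⟩ := Finset.mem_biUnion.1 hz
    obtain ⟨-, x₁, hx₁, x₂, hne⟩ := Finset.mem_filter.1 hα
    exact ⟨x₁, blockK_subset_blockK_succ k y hx₁, hdiam α x₁ (hrow x₁ hx₁ α x₂ hne) z hzα⟩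

/-- **THE ENTRIES OF `Δ_{k,loc}(u) + κP(u_k)` AT `(y₁, y₂)` DEPEND ON `u` ONLY ON THE BONDS INSIDE `depSet y₁ ∪ depSet y₂`.**
[cite: BalabanImbrieJaffe1988, (2.40) p.264, p.264 ("O(r(e_k))-neighborhood of x₁, x₂")] -/
theorem op240_apply_congr (hk1 : j + k + 1 ≤ P.m + P.K) {a c : ℝ} (κ : ℝ) {y₁ y₂ : Balaban1983to89.Site P (j+k)}
    (h : BondAgree (depSet k cube lam ζ'' y₁ ∪ depSet k cube lam ζ'' y₂) U U') :
    op240 (deltaLocT a c U k cube lam ζ'') κ (lineIter U k) y₁ y₂ = op240 (deltaLocT a c U' k cube lam ζ'') κ (lineIter U' k) y₁ y₂ := by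
  have hk : j + k ≤ P.m + P.K := by omega
  unfold op240
  rw [Matrix.add_apply, Matrix.add_apply, Matrix.smul_apply, Matrix.smul_apply,
    deltaLocT_apply_congr hk (h.left.mono (blockK_subset_depSet y₁)) (h.right.mono (blockK_subset_depSet y₂))
      (fun x₁ hx₁ x₂ _ α hα => h.left.mono (cube_subset_depSet hx₁ hα)),
    pOp_lineIter_apply_congr hk1 (h.left.mono (blockK_succ_subset_depSet y₁)) (h.right.mono (blockK_succ_subset_depSet y₂))]

/-- realification commutes with entrywise agreement. [cite: BalabanImbrieJaffe1988, (4.9) p.275] -/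
theorem realify_apply_congr {S : Type*} {M M' : Matrix S S ℂ} {p q : S × Fin 2} (h : M p.1 q.1 = M' p.1 q.1) :
    realify M p q = realify M' p q := by
  simp only [realify, Matrix.of_apply, h]

/-- **agreement of the charted realified operators on a site set `S ⊂ ℤ^d`** (p13's `AgreeOn`) from entrywise agreement of the complex
operators on the sites of `Λ` charted into `S`. [cite: BalabanImbrieJaffe1988, (2.46) p.264] -/
theorem agreeOn_reOp {Λ : Finset (Balaban1983to89.Site P j)} {S : Finset (Fin P.d → ℤ)}
    {H H' : Matrix (Balaban1983to89.Site P j) (Balaban1983to89.Site P j) ℂ}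
    (h : ∀ y₁ ∈ Λ, ∀ y₂ ∈ Λ, chart y₁ ∈ S → chart y₂ ∈ S → H y₁ y₂ = H' y₁ y₂) : AgreeOn S (reOp Λ H) (reOp Λ H') := by
  intro p q hp hq
  obtain ⟨p', rfl⟩ := (idxEquiv Λ).surjective p
  obtain ⟨q', rfl⟩ := (idxEquiv Λ).surjective q
  rw [coe_idxEquiv_fst] at hp hq
  rw [reOp_apply, reOp_apply]
  exact realify_apply_congr (by simp only [compress, Matrix.submatrix_apply]; exact h _ p'.1.2 _ q'.1.2 hp hq)

open Classical in
/-- **the `u`-neighbourhood of a set `S` of charted sites**: the union of the dependence sets of the rows `y ∈ Λ` charted into `S`.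
[cite: BalabanImbrieJaffe1988, p.264 ("O(r(e_k))-neighborhood of x₁, x₂")] -/
def uNbhd (k : ℕ) (Λ : Finset (Balaban1983to89.Site P (j+k))) (cube : ι → Finset (Balaban1983to89.Site P j))
    (lam : ι → Balaban1983to89.Site P j → Balaban1983to89.Site P j → ℝ) (ζ'' : Balaban1983to89.Site P j → Balaban1983to89.Site P j → ℝ)
    (S : Finset (Fin P.d → ℤ)) : Finset (Balaban1983to89.Site P j) :=
  (Λ.filter fun y => chart y ∈ S).biUnion (depSet k cube lam ζ'')

/-- a row charted into `S` has its dependence set inside the neighbourhood. [cite: BalabanImbrieJaffe1988, p.264] -/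
theorem depSet_subset_uNbhd {Λ : Finset (Balaban1983to89.Site P (j+k))} {S : Finset (Fin P.d → ℤ)} {y : Balaban1983to89.Site P (j+k)}
    (hy : y ∈ Λ) (hS : chart y ∈ S) : depSet k cube lam ζ'' y ⊆ uNbhd k Λ cube lam ζ'' S := by
  classical
  intro z hz
  exact Finset.mem_biUnion.2 ⟨y, Finset.mem_filter.2 ⟨hy, hS⟩, hz⟩

/-- **THE CHARTED REALIFIED `(Δ_{k,loc}(u) + κP(u_k))|_Λ` AGREES ON `S` FOR TWO BACKGROUNDS THAT AGREE ON THE BONDS INSIDE `uNbhd S`.**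
[cite: BalabanImbrieJaffe1988, (2.40) p.264, (2.46) p.264] -/
theorem agreeOn_reOp_op240 (hk1 : j + k + 1 ≤ P.m + P.K) {Λ : Finset (Balaban1983to89.Site P (j+k))} {a c : ℝ} (κ : ℝ)
    {S : Finset (Fin P.d → ℤ)} (h : BondAgree (uNbhd k Λ cube lam ζ'' S) U U') :
    AgreeOn S (reOp Λ (op240 (deltaLocT a c U k cube lam ζ'') κ (lineIter U k)))
      (reOp Λ (op240 (deltaLocT a c U' k cube lam ζ'') κ (lineIter U' k))) :=
  agreeOn_reOp fun _ hy₁ _ hy₂ hS₁ hS₂ =>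
    op240_apply_congr hk1 κ (h.mono (union_subset (depSet_subset_uNbhd hy₁ hS₁) (depSet_subset_uNbhd hy₂ hS₂)))

end Op240

/-! ## §8 The printed clauses of (2.43) and (2.46) for the model's `C^{(k)}_Λ(u)` (p13's `BIJ88Locality246Lattice` BY NAME) -/

section Clauses

variable {k : ℕ} {ι : Type*} [Fintype ι] {U U' : GaugeField P j U1} {Λ : Finset (Balaban1983to89.Site P (j+k))} {a c : ℝ}
  {cube : ι → Finset (Balaban1983to89.Site P j)} {lam : ι → Balaban1983to89.Site P j → Balaban1983to89.Site P j → ℝ}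
  {ζ'' : Balaban1983to89.Site P j → Balaban1983to89.Site P j → ℝ} {M : ℕ}

/-- **(2.43), LOCALITY CLAUSE, FOR THE MODEL'S `C^{(k)}_Λ(u) = [(Δ_{k,loc}(u) + κP(u_k))|_Λ]^{−1}`** — *"The local part
C^{(k)}_{Λ,loc}(u; x₁, x₂) depends only on u in an O(r(e_k)) neighborhood of x₁, x₂"*: for ANY `a, c, κ`, cube family, weights, cut-off, cubes
`M ≥ 1` and radius `ρ`: if `u = u′` on the bonds inside the `u`-neighbourhood (`uNbhd`) of the sites of `Λ` within `(ρ + 1)M` (chart distance) of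
`x₁` AND of `x₂`, then the local parts (2.43) of the walk expansions of `C^{(k)}_Λ(u)` and `C^{(k)}_Λ(u′)` at `(x₁, x₂)` coincide (all real
components) — §7 + p13's `cLoc_congr_local`; termwise, no smallness of `u`. [cite: BalabanImbrieJaffe1988, (2.43) p.264] -/
theorem cLoc_congr_bonds (hk1 : j + k + 1 ≤ P.m + P.K) (hM : 0 < M) (κ ρ : ℝ) (p q : B4.Idx (chartSet Λ) 2)
    (h : BondAgree (uNbhd k Λ cube lam ζ'' (nbhd M ρ p ∩ nbhd M ρ q)) U U') :
    cLoc (ldist (N := 2) M) ρ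
        (fun ω y₁ y₂ => latticeCw M (chartSet Λ) 2 (reOp Λ (op240 (deltaLocT a c U k cube lam ζ'') κ (lineIter U k))) ω y₁ y₂) p q =
      cLoc (ldist (N := 2) M) ρ
        (fun ω y₁ y₂ => latticeCw M (chartSet Λ) 2 (reOp Λ (op240 (deltaLocT a c U' k cube lam ζ'') κ (lineIter U' k))) ω y₁ y₂) p q :=
  cLoc_congr_local hM ρ p q (agreeOn_reOp_op240 hk1 κ h)

/-- **(2.46), LOCALITY CLAUSE, FOR THE MODEL'S `C^{(k)}_Λ(u)`** — *"The operator C^{(k)}_{Λ,X}(u) depends only on u in X"*: for ANY data,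
cubes `M ≥ 1`, `r(e_k)`-cubes of `s` labels, radius `ρ` and cube set `X`: if `u = u′` on the bonds inside the `u`-neighbourhood of the sites of
`X` (p13's `sitesOf X`), then `C^{(k)}_{Λ,X}(u) = C^{(k)}_{Λ,X}(u′)` entrywise — §7 + p13's `cX_congr_local`.
[cite: BalabanImbrieJaffe1988, (2.46) p.264] -/
theorem cX_congr_bonds (hk1 : j + k + 1 ≤ P.m + P.K) (hM : 0 < M) (κ ρ : ℝ) {s : ℕ} (X : Finset (Cubes M s (chartSet Λ)))
    (p q : B4.Idx (chartSet Λ) 2) (h : BondAgree (uNbhd k Λ cube lam ζ'' (sitesOf M s X)) U U') :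
    cX (ldist (N := 2) M) ρ (cubeOf M s) touch
        (fun ω y₁ y₂ => latticeCw M (chartSet Λ) 2 (reOp Λ (op240 (deltaLocT a c U k cube lam ζ'') κ (lineIter U k))) ω y₁ y₂) X p q =
      cX (ldist (N := 2) M) ρ (cubeOf M s) touch
        (fun ω y₁ y₂ => latticeCw M (chartSet Λ) 2 (reOp Λ (op240 (deltaLocT a c U' k cube lam ζ'') κ (lineIter U' k))) ω y₁ y₂) X p q :=
  cX_congr_local hM ρ X p q (agreeOn_reOp_op240 hk1 κ h)

/-- **(2.43), VANISHING CLAUSE, FOR ANY CHARTED TORUS OPERATOR** — *"it vanishes for |x₁ − x₂| > ½r(e_k)"*: the local part of the walk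
expansion of `reOp Λ H` at `(x₁, x₂)` is `0` as soon as `|x₁ − x₂|_chart/M > 2ρ` (`ρM = ¼r(e_k)`) — p13's `cLoc_eq_zero_of_far` with the label-unit
site distance `sdist` read through the chart (gen 23's `dist_idxEquiv`). [cite: BalabanImbrieJaffe1988, (2.43) p.264] -/
theorem cLoc_reOp_eq_zero_of_far {H : Matrix (Balaban1983to89.Site P (j+k)) (Balaban1983to89.Site P (j+k)) ℂ} (ρ : ℝ) {p q : ↥Λ × Fin 2}
    (hfar : 2 * ρ < cdist p.1.1 q.1.1 / M) :
    cLoc (ldist (N := 2) M) ρ (fun ω y₁ y₂ => latticeCw M (chartSet Λ) 2 (reOp Λ H) ω y₁ y₂) (idxEquiv Λ p) (idxEquiv Λ q) = 0 :=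
  cLoc_eq_zero_of_far _ ρ _ (sdist (N := 2) M) (fun l x₁ x₂ => sdist_le_ldist_add l x₁ x₂) (by rwa [sdist, dist_idxEquiv])

end Clauses

end

end Literature.MathematicalPhysics.QuantumFieldTheory.BalabanImbrieJaffe1984to88.BIJ88DeltaLocULocalityTorus
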